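import Summits.CriticalPhenomena.CardyFormulaZ2.Theses.CardyRotToConf
import Literature.Topology.PlaneTopology.CrosscutProofs
import HarnessLib

/-!
# Newman's cross-cut theorem re-indexed at the target
# (one-shot surgery for crux `CardyRotToConfR2SymmetryUpgrade`, stmt-CriticalPhenomena-0698)

A crosscut of `(D; a, b)` from `a` to `q ≠ b` splits `D ∖ L` into the component adjacent to `b` and the
other one (`exists_crosscut_split`).
Negative lane: no Theses statement is asserted; overview in `Negative/OneShotSurgery.lean`.
-/

noncomputable section

open Set Filter Topology Bornology
open Literature.Probability.RandomPlanarGeometry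
open Literature.Topology.PlaneTopology

namespace Summit.CriticalPhenomena.CardyFormulaZ2.Theorems.CardyRotToConfR2SymmetryUpgrade.Negative

variable (D : DobrushinDomain)

/-- The first marked parameter is `< mark 1 < 1 ≤ mark 0 + 1`. [folklore] -/
theorem mark_zero_lt_mark_one : D.mark 0 < D.mark 1 :=
  D.strictMono_mark (by decide : (0 : Fin 2) < 1)

/-- `mark_one_lt_mark_zero_add_one`: mark one lt mark zero add one (auxiliary lemma of the one-shot surgery; the statement is the specification). -/
theorem mark_one_lt_mark_zero_add_one : D.mark 1 < D.mark 0 + 1 := by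
  have h1 := (D.mark_mem 1).2
  have h0 := (D.mark_mem 0).1
  linarith

/-- A frontier point other than `a = D.pt 0` has a boundary parameter strictly inside the period
`(mark 0, mark 0 + 1)`. [folklore] -/
theorem exists_param_of_mem_frontier {q : ℂ} (hq : q ∈ frontier D.carrier) (hqa : q ≠ D.pt 0) :
    ∃ t : ℝ, D.mark 0 < t ∧ t < D.mark 0 + 1 ∧ D.boundary t = q := by
  rw [← D.range_boundary] at hq
  obtain ⟨v, rfl⟩ := hq
  obtain ⟨w, hw, hwv⟩ := D.periodic_boundary.exists_mem_Ico one_pos v (D.mark 0)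
  refine ⟨w, lt_of_le_of_ne hw.1 ?_, hw.2, hwv.symm⟩
  rintro rfl
  exact hqa (by rw [hwv]; rfl)

section Split

variable {D}
variable {L : Set ℂ} {q : ℂ} (hL : D.IsCrosscut L (D.pt 0) q) (hqb : q ≠ D.pt 1)
include hL hqb

/-- **Newman's cross-cut theorem, re-indexed at the target.** A crosscut `L` of `(D; a, b)` from
`a` to `q ≠ b` splits `D ∖ L` into the component `U` ADJACENT TO `b` and the other component `V`:
both open and connected, disjoint, `U ∪ V = D ∖ L`, `frontier U = L ∪ A`, `frontier V = L ∪ A'`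
where `A`, `A'` are the two boundary arcs cut off by `a` and `q` (simple arcs, `A ∪ A' = ∂D`,
`A ∩ A' ⊆ {a, q}`), and `b ∈ A`, `b ∉ A'`. [cite: Newman1939, Ch. V §11, Thms. 11·7 and 11·8] -/
theorem exists_crosscut_split :
    ∃ U V A A' : Set ℂ, IsOpen U ∧ IsOpen V ∧ IsConnected U ∧ IsConnected V ∧ Disjoint U V ∧
      U ∪ V = D.carrier \ L ∧ frontier U = L ∪ A ∧ frontier V = L ∪ A' ∧
      A ∪ A' = frontier D.carrier ∧ A ∩ A' ⊆ {D.pt 0, q} ∧ D.pt 1 ∈ A ∧ D.pt 1 ∉ A' ∧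
      IsSimpleArc A (D.pt 0) q ∧ IsSimpleArc A' q (D.pt 0) ∧ A ⊆ frontier D.carrier ∧
      A' ⊆ frontier D.carrier := by
  obtain ⟨t, hst, hts, hqt⟩ := exists_param_of_mem_frontier D hL.2.2.1 hL.2.2.2.1.symm
  have hL' : D.IsCrosscut L (D.boundary (D.mark 0)) (D.boundary t) := by rwa [hqt]
  obtain ⟨U₁, U₂, hU₁o, hU₂o, hU₁c, hU₂c, hdisj, hunion, hfr₁, hfr₂⟩ :=
    Newman1939_crosscut_holds D.toJordanDomain L (D.mark 0) t hst hts hL'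
  -- the two arcs
  set A₁ : Set ℂ := D.boundary '' Icc (D.mark 0) t with hA₁
  set A₂ : Set ℂ := D.boundary '' Icc t (D.mark 0 + 1) with hA₂
  have hcover : A₁ ∪ A₂ = frontier D.carrier := (D.frontier_eq_union_image_boundary (D.mark 0) t).symm
  have hinter : A₁ ∩ A₂ ⊆ {D.pt 0, q} := by
    have := D.image_boundary_inter_subset hst hts
    rwa [hqt] at this
  have hsa₁ : IsSimpleArc A₁ (D.pt 0) q := by
    have := D.isSimpleArc_image_boundary hst hts
    rwa [hqt] at this
  have hsa₂ : IsSimpleArc A₂ q (D.pt 0) := by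
    have := D.isSimpleArc_image_boundary (s := t) (t := D.mark 0 + 1) hts (by linarith)
    rw [hqt, D.periodic_boundary] at this
    exact this
  have hA₁fr : A₁ ⊆ frontier D.carrier := hcover ▸ subset_union_left
  have hA₂fr : A₂ ⊆ frontier D.carrier := hcover ▸ subset_union_right
  -- where is `b`?
  have hb₁ : D.mark 0 < D.mark 1 := mark_zero_lt_mark_one D
  have hb₂ : D.mark 1 < D.mark 0 + 1 := mark_one_lt_mark_zero_add_one D
  have hbt : D.mark 1 ≠ t := by
    rintro h
    exact hqb (by rw [← hqt, ← h]; rfl)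
  -- membership of `b` in an arc is decided by the parameter (injectivity on the period)
  have key : ∀ {u v : ℝ}, D.mark 0 ≤ u → v ≤ D.mark 0 + 1 → D.pt 1 ∈ D.boundary '' Icc u v →
      ∃ w ∈ Icc u v, w = D.mark 1 ∨ w = D.mark 1 + 1 ∨ w + 1 = D.mark 1 := by
    intro u v hu hv hmem
    obtain ⟨w, hw, hwb⟩ := hmem
    refine ⟨w, hw, ?_⟩
    -- both `w` and `mark 1` map to `b`; reduce `w` to the fundamental period of `mark 1`
    rcases lt_or_ge w 1 with hw1 | hw1
    · left
      exact D.injOn_boundary ⟨(D.mark_mem 0).1.trans (hu.trans hw.1), hw1⟩ (D.mark_mem 1) hwb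
    · right; left
      have hw' : w - 1 ∈ Ico (0 : ℝ) 1 :=
        ⟨by linarith, by linarith [hw.2, hv, (D.mark_mem 0).2]⟩
      have hwb' : D.boundary (w - 1) = D.boundary (D.mark 1) := by
        rw [show w - 1 = w - (1 : ℕ) * (1 : ℝ) by ring, D.periodic_boundary.sub_nat_mul_eq]
        exact hwb
      have := D.injOn_boundary hw' (D.mark_mem 1) hwb'
      linarith
  rcases lt_or_gt_of_ne hbt with hlt | hgt
  · -- `b ∈ A₁`, the `b`-component is `U₁`
    have hbA₁ : D.pt 1 ∈ A₁ := ⟨D.mark 1, ⟨hb₁.le, hlt.le⟩, rfl⟩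
    have hbA₂ : D.pt 1 ∉ A₂ := by
      intro hmem
      obtain ⟨w, hw, h | h | h⟩ := key hst.le le_rfl hmem
      · linarith [hw.1]
      · linarith [hw.2]
      · linarith [hw.1, (D.mark_mem 1).2, (D.mark_mem 0).1]
    exact ⟨U₁, U₂, A₁, A₂, hU₁o, hU₂o, hU₁c, hU₂c, hdisj, hunion, hfr₁, hfr₂, hcover, hinter, hbA₁,
      hbA₂, hsa₁, hsa₂, hA₁fr, hA₂fr⟩
  · -- `b ∈ A₂`, the `b`-component is `U₂`
    have hbA₂ : D.pt 1 ∈ A₂ := ⟨D.mark 1, ⟨hgt.le, hb₂.le⟩, rfl⟩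
    have hbA₁ : D.pt 1 ∉ A₁ := by
      intro hmem
      obtain ⟨w, hw, h | h | h⟩ := key le_rfl hts.le hmem
      · linarith [hw.2]
      · linarith [hw.2, (D.mark_mem 1).1]
      · linarith [hw.1, (D.mark_mem 1).2, (D.mark_mem 0).1]
    refine ⟨U₂, U₁, A₂, A₁, hU₂o, hU₁o, hU₂c, hU₁c, hdisj.symm, by rw [union_comm, hunion], hfr₂,
      hfr₁, by rw [union_comm, hcover], by rw [inter_comm]; exact hinter, hbA₂, hbA₁, ?_, ?_,
      hA₂fr, hA₁fr⟩
    · exact hsa₂.symm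
    · exact hsa₁.symm

end Split

end Summit.CriticalPhenomena.CardyFormulaZ2.Theorems.CardyRotToConfR2SymmetryUpgrade.Negative
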